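import Literature.NumberTheory.EllipticCurves.NewformGaloisRepModLOfRegularAlgebraicProofs
import Literature.NumberTheory.Automorphic.NewformAutomorphicRepArchParameter
import Literature.NumberTheory.Automorphic.HeckeCharacterOfDirichletLevel
import Literature.NumberTheory.Automorphic.AutomorphicTwistWeightOne
import Literature.NumberTheory.Automorphic.AlgebraicityTwist
import Literature.NumberTheory.Automorphic.GLnAdelicStructureProofs
import HarnessLib

/-!
# Deligne–Serre, Thm. 6.7 (weight one, every `λ`) from Harris–Lan–Taylor–Thorne's Thm. A: the
# adelic dictionary `f ↦ π_f` is a theorem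

Topic `NumberTheory/EllipticCurves`; theorems only (no definition, no named fact; D-0026). The
hypothesis `hdict` of `thm67_weightOne_of_theoremA_of_dictionary`
(`NewformGaloisRepModLOfRegularAlgebraicProofs`) — "for an eigenform `g ∈ S_k(M, χ)`, `k ≥ 2`, there
is a regular algebraic cuspidal automorphic representation `π` of `GL₂(𝔸_ℚ)` whose Satake parameter
at every `p ∤ M` is `{(√p β₁)⁻¹, (√p β₂)⁻¹}`, `β₁, β₂` the roots of `X² - a_p X + χ(p) p^{k-1}`" — is
PROVED (`hdict_holds`), by assembling the adelic dictionary of the `NewformAdelisation*` /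
`NewformAutomorphicRep*` files:

1. `exists_cuspidalAutomorphicRepData_archParameter_satake_of_eigenform`: `φ_g` generates a cuspidal
   `P` with archimedean parameter `{(k-1)/2, (1-k)/2}` and unitary Satake parameters `{α₁, α₂}`,
   `α₁ + α₂ = a_p p^{(1-k)/2}`, `α₁ α₂ = χ(p)` (Gelbart 1975, §3; Gelbart 1997, (2.5.1));
2. twist by the finite-order Hecke character `ψ_{χ⁻¹}` (`AutomorphicRepData.twist`; archimedean
   parameter unchanged, `HasArchParameter.twist`; Satake parameters `χ(p)⁻¹ αᵢ` at `p ∤ M`,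
   `HasSatakeParamAt.twist_of_isUnramifiedAt` with the level `(M)` of
   `HeckeCharacter.ofDirichlet_det_eq_one_of_mem_principalCongruenceLevel`);
3. twist by `|det|^{k/2}` (`CuspidalAutomorphicRepData.exists_twist_hasInfinityType`; infinity type
   `{(k-½, ½), (½, k-½)}`, regular and C-algebraic for `k ≥ 2`; Satake parameters `p^{-k/2} χ(p)⁻¹ αᵢ`,
   `HasSatakeParamAt.of_map_mulChar_detTwist_of_cpow`);
4. `{p^{-k/2} χ(p)⁻¹ α₁, p^{-k/2} χ(p)⁻¹ α₂} = {(√p β₁)⁻¹, (√p β₂)⁻¹}` (`βᵢ = p^{(k-1)/2} αᵢ`,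
   `α₁ α₂ = χ(p)`; `twistedSatake_eq_roots_map`).

Hence `thm67_weightOne_of_theoremA`: **Deligne–Serre's Thm. 6.7 in weight one, for every prime `λ`
of the coefficient field, follows from Harris–Lan–Taylor–Thorne's Thm. A** (the tree's node
`HarrisLanTaylorThorne2016.theoremA_existence`, which supplies Deligne's Thm. 6.1 in the
`ℚ̄_ℓ`-form `deligne_padicAlgCl_of_theoremA_of_dictionary`) — with no further hypothesis
(`isCompact_glFiniteIntegralLevel_holds`).

## References

* P. Deligne, J.-P. Serre, *Formes modulaires de poids 1*, ASENS 7 (1974), Thm. 6.7, Thm. 6.1,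
  (6.12)–(6.13). [DeligneSerreASENS1974]
* M. Harris, K.-W. Lan, R. Taylor, J. Thorne, *On the rigid cohomology of certain Shimura
  varieties*, Res. Math. Sci. 3 (2016), Thm. A. [HarrisLanTaylorThorneRMS2016]
* S. Gelbart, *Automorphic forms on adele groups* (1975), §3, (3.8), Prop. 3.1. [Gelbart1975]
* S. Gelbart, *Three lectures …* (1997), Prop. 2.5, (2.5.1), Remark 2.5.5. [Gelbart1997]
* J. Arthur, L. Clozel, *Simple algebras, base change, …* (1989), Ch. 3, p. 172. [ArthurClozelAMS120]
-/

noncomputable section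

open scoped MatrixGroups ModularForm NumberField Polynomial
open CongruenceSubgroup IsDedekindDomain Polynomial Rat.HeightOneSpectrum NumberField

namespace Literature.NumberTheory.EllipticCurves.ModularForms.DeligneSerre1974

open Literature.NumberTheory.Automorphic Literature.NumberTheory.GaloisRepresentations
  Literature.NumberTheory.EllipticCurves.ModularForms

/-! ### Algebra of the two Satake normalisations -/

/-- `(X - x)(X - y) = X² - (x + y) X + x y`. [folklore] -/
private theorem X_sub_C_mul_X_sub_C (x y : ℂ) :
    (X - C x) * (X - C y) = X ^ 2 - C (x + y) * X + C (x * y) := by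
  simp only [map_add, map_mul]; ring

/-- The Satake polynomial of a pair. [folklore] -/
private theorem satakePolynomial_pair' (x y : ℂ) :
    satakePolynomial ({x, y} : Multiset ℂ) = X ^ 2 - C (x + y) * X + C (x * y) := by
  rw [satakePolynomial, Multiset.insert_eq_cons, Multiset.map_cons, Multiset.map_singleton, Multiset.prod_cons,
    Multiset.prod_singleton, X_sub_C_mul_X_sub_C]

/-- Coefficients of a monic quadratic. [folklore] -/
private theorem coeff_quadratic (s t : ℂ) :
    (X ^ 2 - C s * X + C t : ℂ[X]).coeff 0 = t ∧ (X ^ 2 - C s * X + C t : ℂ[X]).coeff 1 = -s := by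
  constructor
  · simp [coeff_X_pow, coeff_X, coeff_C]
  · simp [coeff_X_pow, coeff_C]

/-- `p^{-k/2} = (√p)^{-k}` as complex numbers (`p > 0`). [folklore] -/
private theorem natCast_cpow_neg_half_eq (p : ℕ) (k : ℤ) :
    (p : ℂ) ^ (-((((k : ℝ) / 2 : ℝ)) : ℂ)) = ((Real.sqrt p : ℝ) : ℂ) ^ (-k) := by
  have hp0 : (0 : ℝ) ≤ (p : ℝ) := Nat.cast_nonneg p
  rw [← Complex.ofReal_natCast, ← Complex.ofReal_neg, ← Complex.ofReal_cpow hp0, ← Complex.ofReal_zpow]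
  congr 1
  rw [Real.sqrt_eq_rpow, ← Real.rpow_intCast, ← Real.rpow_mul hp0]
  congr 1
  push_cast
  ring

/-- **The two Satake normalisations of a holomorphic eigenform agree up to the twist
`χ(p)⁻¹ |·|^{k/2}`**: if `∏_{x ∈ α}(X - x) = X² - a (√p)^{1-k} X + e` (`e = χ(p) ≠ 0`, the unitary
parameter of `π_g`), then `{p^{-k/2} e⁻¹ x : x ∈ α} = {(√p β)⁻¹ : β root of X² - a X + e p^{k-1}}`
(`β = (√p)^{k-1} x`, `x₁ x₂ = e`). [folklore] -/
theorem twistedSatake_eq_roots_map {p : ℕ} (hp : 0 < p) (k : ℤ) (a e : ℂ) (he : e ≠ 0) {α : Multiset ℂ}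
    (hα : satakePolynomial α = X ^ 2 - C (a * ((Real.sqrt p : ℝ) : ℂ) ^ (1 - k)) * X + C e) :
    (α.map (e⁻¹ * ·)).map (((p : ℂ) ^ (-((((k : ℝ) / 2 : ℝ)) : ℂ))) * ·) =
      ((X ^ 2 - C a * X + C (e * (p : ℂ) ^ (k - 1)) : ℂ[X])).roots.map
        (fun β => (((Real.sqrt p : ℝ) : ℂ) * β)⁻¹) := by
  set r : ℂ := ((Real.sqrt p : ℝ) : ℂ) with hr
  have hr0 : r ≠ 0 := by
    rw [hr]; exact_mod_cast (Real.sqrt_pos.2 (Nat.cast_pos.2 hp)).ne'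
  have hr2 : r ^ 2 = (p : ℂ) := by
    rw [hr, ← Complex.ofReal_pow, Real.sq_sqrt (Nat.cast_nonneg _), Complex.ofReal_natCast]
  -- `α = {x, y}`
  have hcard : Multiset.card α = 2 := by
    have h := natDegree_satakePolynomial α
    rw [hα] at h
    have h2 : (X ^ 2 - C (a * r ^ (1 - k)) * X + C e : ℂ[X]).natDegree = 2 := by
      compute_degree!
    omega
  obtain ⟨x, y, rfl⟩ := Multiset.card_eq_two.1 hcard
  rw [satakePolynomial_pair'] at hα
  have h0 := congrArg (fun q : ℂ[X] => q.coeff 0) hα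
  have h1 := congrArg (fun q : ℂ[X] => q.coeff 1) hα
  simp only [(coeff_quadratic _ _).1, (coeff_quadratic _ _).2, neg_inj] at h0 h1
  -- `h0 : x * y = e`, `h1 : x + y = a * r ^ (1 - k)`
  have hx0 : x ≠ 0 := fun h => he (by rw [← h0, h, zero_mul])
  have hy0 : y ≠ 0 := fun h => he (by rw [← h0, h, mul_zero])
  -- the roots `r^{k-1} x`, `r^{k-1} y` of the arithmetic polynomial
  set c : ℂ := r ^ (k - 1) with hc
  have hc0 : c ≠ 0 := zpow_ne_zero _ hr0
  have hQ : (X ^ 2 - C a * X + C (e * (p : ℂ) ^ (k - 1)) : ℂ[X]) = satakePolynomial ({c * x, c * y} : Multiset ℂ) := by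
    rw [satakePolynomial_pair']
    have ha : a = c * (x + y) := by
      rw [h1, hc, mul_comm, mul_assoc, ← zpow_add₀ hr0, show (1 - k + (k - 1) : ℤ) = 0 by ring, zpow_zero, mul_one]
    have hep : e * (p : ℂ) ^ (k - 1) = c * x * (c * y) := by
      rw [← h0, ← hr2, hc, ← zpow_natCast, ← zpow_mul]
      push_cast
      rw [show (2 * (k - 1) : ℤ) = (k - 1) + (k - 1) by ring, zpow_add₀ hr0]
      ring
    rw [ha, hep, mul_add]
  rw [hQ, roots_satakePolynomial]
  -- both sides are the same pair
  have hpow : (p : ℂ) ^ (-((((k : ℝ) / 2 : ℝ)) : ℂ)) = r ^ (-k) := natCast_cpow_neg_half_eq p k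
  simp only [Multiset.insert_eq_cons, Multiset.map_cons, Multiset.map_singleton, hpow]
  have hrc : r * c = r ^ k := by
    rw [hc, ← zpow_one_add₀ hr0, show (1 + (k - 1) : ℤ) = k by ring]
  -- `(r (c x))⁻¹ = r^{-k} e⁻¹ y` and symmetrically
  have ex : (r * (c * x))⁻¹ = r ^ (-k) * (e⁻¹ * y) := by
    rw [← mul_assoc, hrc, ← h0, zpow_neg]
    field_simp
  have ey : (r * (c * y))⁻¹ = r ^ (-k) * (e⁻¹ * x) := by
    rw [← mul_assoc, hrc, ← h0, zpow_neg]
    field_simp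
  rw [ex, ey]
  exact Multiset.pair_comm _ _

/-! ### The dictionary -/

variable {N : ℕ} [NeZero N]

set_option maxHeartbeats 800000 in
/-- **The adelic dictionary `g ↦ π_g` (hypothesis `hdict` of
`thm67_weightOne_of_theoremA_of_dictionary`) is a theorem.** For `k ≥ 2`, an eigenform
`g ∈ S_k(M, χ)`, `g ≠ 0`, with `T_p g = a_p g` (`p ∤ M`): the twist
`π = π_g ⊗ (ψ_{χ⁻¹} |·|^{k/2} ∘ det)` of the cuspidal automorphic representation generated by the adelic
lift `φ_g` is a regular algebraic cuspidal automorphic representation of `GL₂(𝔸_ℚ)` (infinity type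
`{(k-½, ½), (½, k-½)}`) whose Satake parameter at every `p ∤ M` is `{(√p β₁)⁻¹, (√p β₂)⁻¹}`,
`β₁, β₂` the roots of `X² - a_p X + χ(p) p^{k-1}`. [cite: Gelbart1975, §3 and (3.8)]
[cite: Gelbart1997, Prop. 2.5, (2.5.1) and Remark 2.5.5] [cite: ArthurClozelAMS120, Ch. 3, proof of Thm. 3.1 (p. 172)] -/
theorem hdict_holds (hcpt : isCompact_glFiniteIntegralLevel 2 ℚ) :
    ∀ (M : ℕ) [NeZero M] (k : ℤ), 2 ≤ k →
      ∀ (g : CuspForm (Gamma1 M) k) (χ : DirichletCharacter ℂ M),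
        g ∈ nebentypusSubspace M k χ → g ≠ 0 →
      ∀ (a : ℕ → ℂ),
        (∀ (p : ℕ) (hp : p.Prime), ¬ p ∣ M →
          (haveI : NeZero p := ⟨hp.ne_zero⟩; heckeT (Gamma1 M) k p g) = a p • g) →
      ∃ π : CuspidalAutomorphicRepData 2 ℚ hcpt, π.1.IsRegularAlgebraic ∧
        ∀ w : HeightOneSpectrum (𝓞 ℚ), ¬ ((primesEquiv w : Nat.Primes) : ℕ) ∣ M →
          π.1.HasSatakeParamAt w
            ((X ^ 2 - C (a ((primesEquiv w : Nat.Primes) : ℕ)) * X +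
                C (χ ((primesEquiv w : Nat.Primes) : ℕ) *
                  (((primesEquiv w : Nat.Primes) : ℕ) : ℂ) ^ (k - 1)) : ℂ[X]).roots.map
              fun β ↦ (((Real.sqrt ((primesEquiv w : Nat.Primes) : ℕ) : ℝ) : ℂ) * β)⁻¹) := by
  intro M _ k hk g χ hg hg0 a haT
  -- 1. the cuspidal representation generated by `φ_g`
  obtain ⟨P, -, -, harch, hsat⟩ :=
    exists_cuspidalAutomorphicRepData_archParameter_satake_of_eigenform (hcpt := hcpt) g hg0 χ hg a haT
  -- 2. the finite-order twist by `ψ_{χ⁻¹}`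
  have hψfin : (HeckeCharacter.ofDirichlet χ⁻¹).IsFiniteOrder := HeckeCharacter.isFiniteOrder_ofDirichlet χ⁻¹
  have harch₁ : (P.twist (HeckeCharacter.ofDirichlet χ⁻¹) hψfin).1.HasArchParameter
      fun _ => ({(((k : ℤ) : ℂ) - 1) / 2, (1 - ((k : ℤ) : ℂ)) / 2} : Multiset ℂ) :=
    AutomorphicRepData.HasArchParameter.twist _ (HeckeCharacter.ofDirichlet χ⁻¹) hψfin harch
  -- 3. the infinity type `{((k-1)/2, (1-k)/2), ((1-k)/2, (k-1)/2)}`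
  let w₁ : ArchWeight := ⟨(((k : ℤ) : ℂ) - 1) / 2, (1 - ((k : ℤ) : ℂ)) / 2, ⟨k - 1, by push_cast; ring⟩⟩
  let T : InfinityType ℚ 2 := fun _ => {w₁, w₁.swap}
  have hTwf : T.IsWellFormed := by
    refine ⟨fun σ => by simp [T], fun σ => ?_⟩
    simp only [T, Multiset.insert_eq_cons, Multiset.map_cons, Multiset.map_singleton, ArchWeight.swap_swap]
    exact Multiset.pair_comm _ _
  have hT₁ : (P.twist (HeckeCharacter.ofDirichlet χ⁻¹) hψfin).1.HasInfinityType T := by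
    refine ⟨hTwf, ?_⟩
    have e : (fun σ : ℚ →+* ℂ => (T σ).map ArchWeight.a) =
        fun _ => ({(((k : ℤ) : ℂ) - 1) / 2, (1 - ((k : ℤ) : ℂ)) / 2} : Multiset ℂ) := by
      funext σ
      simp only [T, Multiset.insert_eq_cons, Multiset.map_cons, Multiset.map_singleton, ArchWeight.swap_a]
      rfl
    rw [e]
    exact harch₁
  -- 4. the norm twist by `|det|^{k/2}`
  obtain ⟨χN, π', hχN, hW, hW', hT'⟩ :=
    CuspidalAutomorphicRepData.exists_twist_hasInfinityType _ ((k : ℝ) / 2) hT₁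
  refine ⟨π', ⟨_, hT', fun σ q hq => ?_, fun σ => ?_⟩, fun w hwM => ?_⟩
  · -- C-algebraic: `a, b ∈ {k - ½, ½} ⊆ ½ + ℤ`
    simp only [InfinityType.twist_apply, T, Multiset.insert_eq_cons, Multiset.map_cons, Multiset.map_singleton,
      Multiset.mem_cons, Multiset.mem_singleton] at hq
    rcases hq with rfl | rfl
    · refine ⟨k - 1, 0, ?_, ?_⟩
      · change (((k : ℤ) : ℂ) - 1) / 2 + (((k : ℝ) / 2 : ℝ) : ℂ) = _
        push_cast; ring
      · change (1 - ((k : ℤ) : ℂ)) / 2 + (((k : ℝ) / 2 : ℝ) : ℂ) = _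
        push_cast; ring
    · refine ⟨0, k - 1, ?_, ?_⟩
      · change (1 - ((k : ℤ) : ℂ)) / 2 + (((k : ℝ) / 2 : ℝ) : ℂ) = _
        push_cast; ring
      · change (((k : ℤ) : ℂ) - 1) / 2 + (((k : ℝ) / 2 : ℝ) : ℂ) = _
        push_cast; ring
  · -- regular: `k - ½ ≠ ½`
    simp only [InfinityType.twist_apply, T, Multiset.insert_eq_cons, Multiset.map_cons, Multiset.map_singleton,
      Multiset.nodup_cons, Multiset.mem_singleton, Multiset.nodup_singleton, and_true]
    change ¬ ((((k : ℤ) : ℂ) - 1) / 2 + (((k : ℝ) / 2 : ℝ) : ℂ) = (1 - ((k : ℤ) : ℂ)) / 2 + (((k : ℝ) / 2 : ℝ) : ℂ))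
    intro h
    have h2 : ((k : ℤ) : ℂ) = 1 := by linear_combination h
    norm_cast at h2
    omega
  · -- 5. the Satake parameter at `w ∤ M`
    obtain ⟨α, hα, hpoly⟩ := hsat w hwM
    have hp : ((primesEquiv (R := 𝓞 ℚ) w : Nat.Primes) : ℕ) = natGenerator w := rfl
    rw [hp] at hwM hpoly ⊢
    have hv : ¬ w.asIdeal ∣ Ideal.span {(M : 𝓞 ℚ)} := fun h => hwM ((Rat.natGenerator_dvd_iff w M).2 h)
    -- the finite-order twist: `χ(p)⁻¹ α`
    have hα₁ := hα.twist_of_isUnramifiedAt hψfin (𝔪 := Ideal.span {(M : 𝓞 ℚ)}) (Rat.span_natCast_ne_zero M)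
      (fun u hu => HeckeCharacter.ofDirichlet_det_eq_one_of_mem_principalCongruenceLevel χ⁻¹ hu) hv
      (HeckeCharacter.isUnramifiedAt_ofDirichlet χ⁻¹ hwM)
    rw [HeckeCharacter.valueAtUniformizer_ofDirichlet χ⁻¹ hwM, GaloisRepresentations.Rat.residueCard_eq_natGenerator,
      MulChar.inv_apply_eq_inv'] at hα₁
    -- the norm twist: `p^{-k/2} χ(p)⁻¹ α`
    have hα₂ := AutomorphicRepData.HasSatakeParamAt.of_map_mulChar_detTwist_of_cpow hχN hW hW' hα₁
    rw [GaloisRepresentations.Rat.residueCard_eq_natGenerator] at hα₂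
    -- the two normalisations agree
    obtain ⟨u, hu⟩ := ZMod.isUnit_prime_of_not_dvd (prime_natGenerator w) hwM
    have he : χ ((natGenerator w : ℕ) : ZMod M) ≠ 0 := by
      rw [← hu]; exact (u.isUnit.map χ).ne_zero
    rw [twistedSatake_eq_roots_map (prime_natGenerator w).pos k (a (natGenerator w)) _ he hpoly] at hα₂
    exact hα₂

/-- **Deligne–Serre, Thm. 6.7 in weight one, for EVERY prime `λ` of the coefficient field, from
Harris–Lan–Taylor–Thorne's Thm. A.** For a newform `f ∈ S₁(Γ₁(N))` and every `ι : 𝓞_{K_f} → 𝔽_ℓ`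
there is a semisimple `ρ : Gal(ℚ̄/ℚ) → GL₂(𝔽_ℓ)`, unramified outside `Nℓ`, with
`det(1 - ρ(Frob_p) T) = 1 - ι(a_p) T + ι(ε(p)) T²` — granted the tree's node
`HarrisLanTaylorThorne2016.theoremA_existence` (which supplies Deligne's Thm. 6.1 for the eigenforms of
weight `≥ 2` through `deligne_padicAlgCl_of_theoremA_of_dictionary`), and nothing else: the adelic
dictionary is `hdict_holds` and the compactness of `GL₂(𝒪̂)` is `isCompact_glFiniteIntegralLevel_holds`.
[cite: DeligneSerreASENS1974, Thm. 6.7 and Thm. 6.1] [cite: HarrisLanTaylorThorneRMS2016, Thm. A (p. 3)] -/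
theorem thm67_weightOne_of_theoremA (hA : HarrisLanTaylorThorne2016.theoremA_existence) :
    thm67_weightOne (N := N) :=
  thm67_weightOne_of_theoremA_of_dictionary hA (isCompact_glFiniteIntegralLevel_holds 2 ℚ)
    (hdict_holds (isCompact_glFiniteIntegralLevel_holds 2 ℚ))

end Literature.NumberTheory.EllipticCurves.ModularForms.DeligneSerre1974
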